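import Literature.Probability.LatticeModels.IsingSAWBound
import Mathlib.Algebra.Order.Field.GeomSum
import HarnessLib

/-!
# `tanh β_c(ℤ³) ≥ 1000/4865`: Fisher's bound with the memory-4 transfer matrix of the simple cubic lattice

Topic `Literature/Probability/LatticeModels`. Theorem-only file (no definition, no named fact, no sorry).
Companion of `IsingSAWBound.lean` (Fisher's criterion `∑_n σ(n) tanh(β)ⁿ < ∞ ⇒ β < β_c(d)`), where the
self-avoiding-walk count was majorised by the crude memory-4 bound `c_{n,4} ≤ (2d)³ ((2d-1)³-1)^{⌊n/3⌋}`
(enough for `tanh β ≤ 1/(2d-1)`). Here, for `d = 3`, the memory-4 count is controlled by its EXACT growth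
rate: the walks with no immediate reversal and no unit square form a finite automaton on the last three
steps whose states fall into three classes — STRAIGHT (`c = b`), U-TURN (`c = -a`), BEND (otherwise) —
with lumped transfer matrix `[[1,4,0],[1,3,1],[1,3,0]]` and Perron root `λ₄`, the real root of
`λ³ = 4λ² + 4λ + 1`, `λ₄ = 4.86453…` (Fisher–Sykes 1959, Appendix A; Madras–Slade 1993, §1.2, (1.2.11)–(1.2.14),
walks with finite memory; the tree's `SAW.Zd.connectiveConstant_cube_le_fisherSykes` (`RandomPlanarGeometry/
SAWFisherSykesBound.lean`) is the same three-class recurrence stated for the connective constant `μ(ℤ^d) ≤ μ₄(d)`;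
here an explicit COUNT bound is needed, which the limit statement does not give). A Perron CERTIFICATE — integer weights
`(10000, 9661, 8014)` on the three classes with `1000·(M u) ≤ 4865·u` entrywise, checked by the kernel
(`decide`, 216 cases) — gives

* `card_memFourWords_three_le` — `c_{n,4}(ℤ³) ≤ 270 · (4865/1000)ⁿ` for all `n`;
* `sum_card_sawWords_three_mul_pow_le` — `∑_{n<N} σ(n) tⁿ ≤ 270 / (1 - 4.865 t)` for `0 ≤ t < 1000/4865`;
* `lt_criticalBeta_three_of_tanh_lt` — **`tanh β < 1000/4865 ⇒ β < β_c(3)`**, i.e.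
  `β_c(ℤ³) ≥ artanh(1000/4865) = 0.20852…` (Fisher's `tanh β_c ≥ 1/μ` with `μ ≤ λ₄ < 4.865`; the crude
  `tanh β ≤ 1/5` of `IsingSAWBound` gave `0.20273`; numerically `β_c(ℤ³) ≈ 0.2217`).

References: M. E. Fisher, Phys. Rev. 162 (1967) 480 [Fisher1967]; M. E. Fisher, M. F. Sykes, Phys. Rev. 114
(1959) 45; N. Madras, G. Slade, *The Self-Avoiding Walk* (1993), §1.2 [MadrasSlade1993].
-/

noncomputable section

open Finset Filter Topology

namespace Literature.Probability.LatticeModels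

open Literature.Probability.Percolation

/-! ### Part 1. The Perron certificate of the three-class memory-4 automaton (kernel check) -/

/-- **The memory-4 Perron certificate for `ℤ³`**: with the class weights `u(a,b,c) = 10000` (straight,
`c = b`), `8014` (U-turn, `c = -a`), `9661` (bend), every no-reversal triple `(a, b, c)` satisfies
`1000 · ∑_{d admissible} u(b,c,d) ≤ 4865 · u(a,b,c)`, `d` admissible meaning no reversal (`d ≠ -c`) and no
unit square (`¬(c = -a ∧ d = -b)`). Kernel-checked over the `216` triples. [cite: FisherSykes1959, Appendix A (A.2)–(A.9)] [cite: MadrasSlade1993, §1.2 ((1.2.11)–(1.2.14))] -/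
theorem memFour_perron_cert (a b c : Fin 3 × Bool) (hb : b ≠ srev a) (hc : c ≠ srev b) :
    1000 * (∑ d : Fin 3 × Bool, if d ≠ srev c ∧ ¬(c = srev a ∧ d = srev b) then
      (if d = c then 10000 else if d = srev b then 8014 else 9661) else 0) ≤
      4865 * (if c = b then 10000 else if c = srev a then 8014 else 9661 : ℕ) := by
  revert a b c
  decide

/-- The prefix of a memory-4 word is a memory-4 word. [folklore] -/
private theorem isMemFour_wordInit {d n : ℕ} {w : Fin (n + 1) → Fin d × Bool} (h : IsMemFour w) : IsMemFour (wordInit w) :=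
  ⟨fun k hk => h.1 k (by omega), fun k hk => h.2 k (by omega)⟩

/-! ### Part 2. The weighted transfer step -/

/-- **One transfer step with the Perron weights**: for every `m`,
`1000 · ∑_{w ∈ c_{m+4,4}} u(w_{m+1}, w_{m+2}, w_{m+3}) ≤ 4865 · ∑_{w ∈ c_{m+3,4}} u(w_m, w_{m+1}, w_{m+2})`
(split a word of length `m + 4` into its prefix and its last step; the last step is admissible after the
last triple of the prefix; apply the certificate). [cite: MadrasSlade1993, §1.2 ((1.2.11)–(1.2.14))] -/
theorem weightSum_memFourWords_succ_le (m : ℕ) :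
    1000 * ∑ w ∈ memFourWords 3 (m + 4),
        (if w ⟨m + 3, by omega⟩ = w ⟨m + 2, by omega⟩ then 10000
          else if w ⟨m + 3, by omega⟩ = srev (w ⟨m + 1, by omega⟩) then 8014 else 9661 : ℕ) ≤
      4865 * ∑ w ∈ memFourWords 3 (m + 3),
        (if w ⟨m + 2, by omega⟩ = w ⟨m + 1, by omega⟩ then 10000
          else if w ⟨m + 2, by omega⟩ = srev (w ⟨m, by omega⟩) then 8014 else 9661 : ℕ) := by
  classical
  -- weights as functions of (prefix, last step)
  set W : (Fin 3 × Bool) → (Fin 3 × Bool) → (Fin 3 × Bool) → ℕ :=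
    fun a b c => if c = b then 10000 else if c = srev a then 8014 else 9661 with hW
  set F : (Fin (m + 4) → Fin 3 × Bool) → (Σ _ : Fin (m + 3) → Fin 3 × Bool, Fin 3 × Bool) :=
    fun w => ⟨wordInit w, w ⟨m + 3, by omega⟩⟩ with hF
  set adm : (Fin (m + 3) → Fin 3 × Bool) → (Fin 3 × Bool) → Prop :=
    fun u e => e ≠ srev (u ⟨m + 2, by omega⟩) ∧ ¬(u ⟨m + 2, by omega⟩ = srev (u ⟨m, by omega⟩) ∧ e = srev (u ⟨m + 1, by omega⟩))
    with hadm
  set T := (memFourWords 3 (m + 3)).sigma fun u => Finset.univ.filter (fun e => adm u e) with hT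
  set G : (Σ _ : Fin (m + 3) → Fin 3 × Bool, Fin 3 × Bool) → ℕ := fun p => W (p.1 ⟨m + 1, by omega⟩) (p.1 ⟨m + 2, by omega⟩) p.2
    with hG
  have hmaps : ∀ w ∈ memFourWords 3 (m + 4), F w ∈ T := by
    intro w hw
    rw [mem_memFourWords] at hw
    rw [hT, Finset.mem_sigma, Finset.mem_filter]
    refine ⟨mem_memFourWords.2 (isMemFour_wordInit hw), Finset.mem_univ _, ?_, ?_⟩
    · have := hw.1 (m + 2) (by omega)
      exact this
    · have := hw.2 m (by omega)
      exact this
  have hinj : Set.InjOn F (memFourWords 3 (m + 4) : Set _) := by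
    intro w _ w' _ h
    simp only [hF, Sigma.mk.injEq, heq_eq_eq] at h
    exact wordInit_last_injective (m + 3) (Prod.ext h.1 h.2)
  -- the left-hand sum through `F`
  have hLHS : ∑ w ∈ memFourWords 3 (m + 4),
      (if w ⟨m + 3, by omega⟩ = w ⟨m + 2, by omega⟩ then 10000
        else if w ⟨m + 3, by omega⟩ = srev (w ⟨m + 1, by omega⟩) then 8014 else 9661 : ℕ) =
      ∑ w ∈ memFourWords 3 (m + 4), G (F w) := by
    refine Finset.sum_congr rfl fun w _ => ?_
    rfl
  have hle1 : ∑ w ∈ memFourWords 3 (m + 4), G (F w) ≤ ∑ p ∈ T, G p := by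
    rw [← Finset.sum_image (fun w hw w' hw' h => hinj (Finset.mem_coe.2 hw) (Finset.mem_coe.2 hw') h)]
    exact Finset.sum_le_sum_of_subset fun p hp => by
      obtain ⟨w, hw, rfl⟩ := Finset.mem_image.1 hp
      exact hmaps w hw
  have hT_sum : ∑ p ∈ T, G p = ∑ u ∈ memFourWords 3 (m + 3), ∑ e ∈ Finset.univ.filter (fun e => adm u e),
      W (u ⟨m + 1, by omega⟩) (u ⟨m + 2, by omega⟩) e := by
    rw [hT, Finset.sum_sigma]
  -- apply the certificate word by word
  have hcert : ∀ u ∈ memFourWords 3 (m + 3),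
      1000 * ∑ e ∈ Finset.univ.filter (fun e => adm u e), W (u ⟨m + 1, by omega⟩) (u ⟨m + 2, by omega⟩) e ≤
        4865 * W (u ⟨m, by omega⟩) (u ⟨m + 1, by omega⟩) (u ⟨m + 2, by omega⟩) := by
    intro u hu
    rw [mem_memFourWords] at hu
    have h1 : u ⟨m + 1, by omega⟩ ≠ srev (u ⟨m, by omega⟩) := hu.1 m (by omega)
    have h2 : u ⟨m + 2, by omega⟩ ≠ srev (u ⟨m + 1, by omega⟩) := hu.1 (m + 1) (by omega)
    rw [Finset.sum_filter]
    exact memFour_perron_cert _ _ _ h1 h2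
  calc 1000 * ∑ w ∈ memFourWords 3 (m + 4),
        (if w ⟨m + 3, by omega⟩ = w ⟨m + 2, by omega⟩ then 10000
          else if w ⟨m + 3, by omega⟩ = srev (w ⟨m + 1, by omega⟩) then 8014 else 9661 : ℕ)
      = 1000 * ∑ w ∈ memFourWords 3 (m + 4), G (F w) := by rw [hLHS]
    _ ≤ 1000 * ∑ p ∈ T, G p := Nat.mul_le_mul_left _ hle1
    _ = ∑ u ∈ memFourWords 3 (m + 3), 1000 * ∑ e ∈ Finset.univ.filter (fun e => adm u e),
          W (u ⟨m + 1, by omega⟩) (u ⟨m + 2, by omega⟩) e := by rw [hT_sum, Finset.mul_sum]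
    _ ≤ ∑ u ∈ memFourWords 3 (m + 3), 4865 * W (u ⟨m, by omega⟩) (u ⟨m + 1, by omega⟩) (u ⟨m + 2, by omega⟩) :=
        Finset.sum_le_sum hcert
    _ = 4865 * ∑ w ∈ memFourWords 3 (m + 3),
        (if w ⟨m + 2, by omega⟩ = w ⟨m + 1, by omega⟩ then 10000
          else if w ⟨m + 2, by omega⟩ = srev (w ⟨m, by omega⟩) then 8014 else 9661 : ℕ) := by
        rw [Finset.mul_sum]

/-- **Iterated transfer step**: `1000ᵐ · Φ(m) ≤ 4865ᵐ · Φ(0)` for the weighted counts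
`Φ(m) = ∑_{w ∈ c_{m+3,4}} u(w_m, w_{m+1}, w_{m+2})`. [cite: MadrasSlade1993, §1.2 ((1.2.11)–(1.2.14))] -/
theorem weightSum_memFourWords_le (m : ℕ) :
    1000 ^ m * ∑ w ∈ memFourWords 3 (m + 3),
        (if w ⟨m + 2, by omega⟩ = w ⟨m + 1, by omega⟩ then 10000
          else if w ⟨m + 2, by omega⟩ = srev (w ⟨m, by omega⟩) then 8014 else 9661 : ℕ) ≤
      4865 ^ m * ∑ w ∈ memFourWords 3 3,
        (if w ⟨2, by omega⟩ = w ⟨1, by omega⟩ then 10000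
          else if w ⟨2, by omega⟩ = srev (w ⟨0, by omega⟩) then 8014 else 9661 : ℕ) := by
  induction m with
  | zero =>
      simp only [pow_zero, one_mul]
      try exact le_rfl
  | succ m ih =>
      have hstep := weightSum_memFourWords_succ_le m
      calc 1000 ^ (m + 1) * ∑ w ∈ memFourWords 3 (m + 1 + 3),
            (if w ⟨m + 1 + 2, by omega⟩ = w ⟨m + 1 + 1, by omega⟩ then 10000
              else if w ⟨m + 1 + 2, by omega⟩ = srev (w ⟨m + 1, by omega⟩) then 8014 else 9661 : ℕ)
          = 1000 ^ m * (1000 * ∑ w ∈ memFourWords 3 (m + 4),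
            (if w ⟨m + 3, by omega⟩ = w ⟨m + 2, by omega⟩ then 10000
              else if w ⟨m + 3, by omega⟩ = srev (w ⟨m + 1, by omega⟩) then 8014 else 9661 : ℕ)) := by
            rw [pow_succ]; ring_nf
        _ ≤ 1000 ^ m * (4865 * ∑ w ∈ memFourWords 3 (m + 3),
            (if w ⟨m + 2, by omega⟩ = w ⟨m + 1, by omega⟩ then 10000
              else if w ⟨m + 2, by omega⟩ = srev (w ⟨m, by omega⟩) then 8014 else 9661 : ℕ)) :=
            Nat.mul_le_mul_left _ hstep
        _ = 4865 * (1000 ^ m * ∑ w ∈ memFourWords 3 (m + 3),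
            (if w ⟨m + 2, by omega⟩ = w ⟨m + 1, by omega⟩ then 10000
              else if w ⟨m + 2, by omega⟩ = srev (w ⟨m, by omega⟩) then 8014 else 9661 : ℕ)) := by ring
        _ ≤ 4865 * (4865 ^ m * ∑ w ∈ memFourWords 3 3,
            (if w ⟨2, by omega⟩ = w ⟨1, by omega⟩ then 10000
              else if w ⟨2, by omega⟩ = srev (w ⟨0, by omega⟩) then 8014 else 9661 : ℕ)) := Nat.mul_le_mul_left _ ih
        _ = 4865 ^ (m + 1) * ∑ w ∈ memFourWords 3 3,
            (if w ⟨2, by omega⟩ = w ⟨1, by omega⟩ then 10000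
              else if w ⟨2, by omega⟩ = srev (w ⟨0, by omega⟩) then 8014 else 9661 : ℕ) := by rw [pow_succ]; ring

/-! ### Part 3. The count `c_{n,4}(ℤ³) ≤ 270 · 4.865ⁿ` and Fisher's bound at `tanh β < 1000/4865` -/

/-- **`c_{m+3,4}(ℤ³) · 8014 · 1000ᵐ ≤ 2160000 · 4865ᵐ`** (every weight is `≥ 8014`, `Φ(0) ≤ 6³ · 10000`).
[cite: MadrasSlade1993, §1.2 ((1.2.11)–(1.2.14))] -/
theorem card_memFourWords_three_mul_le (m : ℕ) :
    (memFourWords 3 (m + 3)).card * 8014 * 1000 ^ m ≤ 2160000 * 4865 ^ m := by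
  classical
  have hlow : (memFourWords 3 (m + 3)).card * 8014 ≤ ∑ w ∈ memFourWords 3 (m + 3),
      (if w ⟨m + 2, by omega⟩ = w ⟨m + 1, by omega⟩ then 10000
        else if w ⟨m + 2, by omega⟩ = srev (w ⟨m, by omega⟩) then 8014 else 9661 : ℕ) := by
    rw [Finset.card_eq_sum_ones, Finset.sum_mul]
    exact Finset.sum_le_sum fun w _ => by split_ifs <;> omega
  have hhigh : ∑ w ∈ memFourWords 3 3,
      (if w ⟨2, by omega⟩ = w ⟨1, by omega⟩ then 10000
        else if w ⟨2, by omega⟩ = srev (w ⟨0, by omega⟩) then 8014 else 9661 : ℕ) ≤ 2160000 := by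
    calc ∑ w ∈ memFourWords 3 3,
          (if w ⟨2, by omega⟩ = w ⟨1, by omega⟩ then 10000
            else if w ⟨2, by omega⟩ = srev (w ⟨0, by omega⟩) then 8014 else 9661 : ℕ)
        ≤ ∑ _w ∈ memFourWords 3 3, 10000 := Finset.sum_le_sum fun w _ => by split_ifs <;> omega
      _ = (memFourWords 3 3).card * 10000 := by rw [Finset.sum_const, smul_eq_mul]
      _ ≤ 6 ^ 3 * 10000 := Nat.mul_le_mul_right _ (by simpa using card_memFourWords_le_pow 3 3)
      _ = 2160000 := by norm_num
  have hmid := weightSum_memFourWords_le m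
  calc (memFourWords 3 (m + 3)).card * 8014 * 1000 ^ m
      ≤ (∑ w ∈ memFourWords 3 (m + 3),
          (if w ⟨m + 2, by omega⟩ = w ⟨m + 1, by omega⟩ then 10000
            else if w ⟨m + 2, by omega⟩ = srev (w ⟨m, by omega⟩) then 8014 else 9661 : ℕ)) * 1000 ^ m :=
        Nat.mul_le_mul_right _ hlow
    _ ≤ 4865 ^ m * 2160000 := by
        rw [mul_comm]
        exact hmid.trans (Nat.mul_le_mul_left _ hhigh)
    _ = 2160000 * 4865 ^ m := by ring

/-- **`c_{n,4}(ℤ³) ≤ 270 · (4865/1000)ⁿ`** for every `n` (real form). [cite: MadrasSlade1993, §1.2 ((1.2.11)–(1.2.14))] -/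
theorem card_memFourWords_three_le (n : ℕ) : ((memFourWords 3 n).card : ℝ) ≤ 270 * (4865 / 1000 : ℝ) ^ n := by
  have hlam : (1 : ℝ) ≤ 4865 / 1000 := by norm_num
  rcases lt_or_ge n 3 with hn | hn
  · -- short words: `c_{n,4} ≤ 6ⁿ ≤ 216 ≤ 270 λⁿ`
    have h1 : ((memFourWords 3 n).card : ℝ) ≤ 6 ^ n := by exact_mod_cast (by simpa using card_memFourWords_le_pow 3 n)
    have h2 : (6 : ℝ) ^ n ≤ 216 := by
      interval_cases n <;> norm_num
    have h3 : (216 : ℝ) ≤ 270 * (4865 / 1000 : ℝ) ^ n := by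
      have := one_le_pow₀ (M₀ := ℝ) hlam (n := n)
      nlinarith
    linarith
  · obtain ⟨m, rfl⟩ : ∃ m, n = m + 3 := ⟨n - 3, by omega⟩
    have h := card_memFourWords_three_mul_le m
    have h' : ((memFourWords 3 (m + 3)).card : ℝ) * 8014 * 1000 ^ m ≤ 2160000 * 4865 ^ m := by exact_mod_cast h
    have hpos : (0 : ℝ) < 1000 ^ m := by positivity
    -- `card ≤ 2160000/8014 · (4865/1000)^m ≤ 270 · λ^m ≤ 270 · λ^{m+3}`
    have hdiv : ((memFourWords 3 (m + 3)).card : ℝ) ≤ 2160000 / 8014 * (4865 / 1000 : ℝ) ^ m := by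
      rw [div_pow, div_mul_div_comm, le_div_iff₀ (by positivity)]
      nlinarith
    have hcoef : (2160000 / 8014 : ℝ) ≤ 270 := by norm_num
    have hpow : (4865 / 1000 : ℝ) ^ m ≤ (4865 / 1000 : ℝ) ^ (m + 3) := pow_le_pow_right₀ hlam (by omega)
    have hpm : (0 : ℝ) ≤ (4865 / 1000 : ℝ) ^ m := by positivity
    calc ((memFourWords 3 (m + 3)).card : ℝ) ≤ 2160000 / 8014 * (4865 / 1000 : ℝ) ^ m := hdiv
      _ ≤ 270 * (4865 / 1000 : ℝ) ^ m := mul_le_mul_of_nonneg_right hcoef hpm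
      _ ≤ 270 * (4865 / 1000 : ℝ) ^ (m + 3) := mul_le_mul_of_nonneg_left hpow (by norm_num)

/-- **The self-avoiding-walk generating function of `ℤ³` below `1000/4865`**:
`∑_{n<N} σ(n) tⁿ ≤ 270/(1 - 4.865 t)` for `0 ≤ t`, `4.865 t < 1`. [cite: MadrasSlade1993, §1.2 ((1.2.11)–(1.2.14))] -/
theorem sum_card_sawWords_three_mul_pow_le {t : ℝ} (ht0 : 0 ≤ t) (ht : 4865 / 1000 * t < 1) (N : ℕ) :
    ∑ n ∈ range N, ((sawWords 3 n).card : ℝ) * t ^ n ≤ 270 / (1 - 4865 / 1000 * t) := by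
  have hr0 : 0 ≤ 4865 / 1000 * t := by positivity
  calc ∑ n ∈ range N, ((sawWords 3 n).card : ℝ) * t ^ n
      ≤ ∑ n ∈ range N, 270 * (4865 / 1000 * t) ^ n := by
        refine sum_le_sum fun n _ => ?_
        have h1 : ((sawWords 3 n).card : ℝ) ≤ (memFourWords 3 n).card := by
          exact_mod_cast card_le_card (sawWords_subset_memFourWords 3 n)
        calc ((sawWords 3 n).card : ℝ) * t ^ n ≤ 270 * (4865 / 1000 : ℝ) ^ n * t ^ n :=
            mul_le_mul_of_nonneg_right (h1.trans (card_memFourWords_three_le n)) (pow_nonneg ht0 n)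
          _ = 270 * (4865 / 1000 * t) ^ n := by rw [mul_pow]; ring
    _ = 270 * ∑ n ∈ range N, (4865 / 1000 * t) ^ n := by rw [mul_sum]
    _ ≤ 270 * (1 / (1 - 4865 / 1000 * t)) := by
        refine mul_le_mul_of_nonneg_left ?_ (by norm_num)
        have hg := geom_sum_Ico_le_of_lt_one (m := 0) (n := N) hr0 ht
        rw [pow_zero, ← Finset.range_eq_Ico] at hg
        exact hg
    _ = 270 / (1 - 4865 / 1000 * t) := by rw [mul_one_div]

/-- **`tanh β < 1000/4865 ⇒ β < β_c(ℤ³)`** (`β ≥ 0`), i.e. `β_c(ℤ³) ≥ artanh(1000/4865) = 0.20852…`: Fisher's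
bound `tanh β_c ≥ 1/μ(ℤ³)` with the memory-4 transfer-matrix estimate `μ(ℤ³) ≤ λ₄ < 4865/1000`.
[cite: Fisher1967, Phys. Rev. 162 (1967) 480 (T_c bounds from self-avoiding walks)] [cite: MadrasSlade1993, §1.2 ((1.2.11)–(1.2.14))] -/
theorem lt_criticalBeta_three_of_tanh_lt {β : ℝ} (hβ : 0 ≤ β) (ht : Real.tanh β < 1000 / 4865) : β < criticalBeta 3 :=
  lt_criticalBeta_of_sawSum_le (d := 3) (by norm_num) hβ
    (sum_card_sawWords_three_mul_pow_le (tanh_nonneg hβ) (by nlinarith))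

end Literature.Probability.LatticeModels

end
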